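import Summits.ABC.StewartYu.PadicG3SatNSched
import Summits.ABC.StewartYu.PadicG3SatCeilings
import Summits.ABC.StewartYu.PadicG3VbSizes
import HarnessLib

/-!
# Cell abc-stewartyu, WP-L.P(odd) (crux r3 `PadicCoreOddRat`, stmt-ABC-20503): SIZES of the saturated frame's closed forms on the record schedule `schedN b`

`Summits/ABC/StewartYu/PadicG3SatNSizes.lean` — cell `abc-stewartyu` (seat p2-g6, pack twin step 2; record owner p1 g10; ruling R28(d)/R31(a)).
Proofs only; no definition, no named fact.  Twin of `PadicG3VbSizes` (p3-g7) for the saturated data `F : S.SatData` and the N-schedule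
`P.schedN b` (`P : PadicG3ParN S.n`; budget letter `W = P.W ≥ log N`, `≥ log max(3,|b̃ₖ|)` by hypothesis `hbW`):

* node sizes transfer verbatim (`NS_N_le_HV`, `NS00_N_le_HV`, `halfNodes_N_le_HV`: the node counts of `schedN` and `schedVb` agree, rfl);
* the VIRTUAL box `svS = N·side`: `Lb_svS_div_le` (`Lb(svS) lev j / N ≤ LV/(2^lev Aⱼ)`), `sum_Lb_svS_div_mul_A_le` (`≤ n·LV/2^lev`);
* the virtual denominators: `log_Dm_N_le` (`log Dm(Lb svS lev, x) ≤ 2|x|·n·LV/2^lev + 2ΣA`), `log_Dh_N_le`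
  (`log Dh(Lb svS lev, s) ≤ |s|·n·LV/2^lev + (n+2)·ΣA` when `Σᵢ|Uᵢⱼ| ≤ n·N`);
* the θ-box `LcS` (`|C_jk| ≤ n!·N`): `cast_LcS`, `LcS_N_le` (`≤ n!·N·n·LV/2`), `sum_Lb_LcS_N_le` (`Σₖ Lb(LcS) lev k ≤ n²·n!·N·LV/2^lev`),
  `XbC_LcS_N_le_exp` / `XbC_LcS_pow_N_le` / `XbSSat_N_le` (`XbC ≤ exp(log 2 + 3 log n + log n! + log N + W + log LV)`),
  `log_UcardSat_N_le` (`log UcardSat ≤ log(L0N+1) + n·log(n²·n!·N·LV + 1)`);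
* heights at the nodes: `nodes_height_N_le`, `start_height_N_le`, `abs_half_mul_le` (`|s₁|·(n LV/2^lev) ≤ (2gXV+1)·n·LV`);
* the `L₀`-factor and `M0C` with `L0N`, `ŜN`: `L0_factor_N_le`, `M0C_N_le_exp`.

WHAT THIS IS NOT: budget lines (next file); no crux moves.

References: Yu. V. Nesterenko, LNM 1819 (2003) §3.2, (3.8), §4; K. Yu, Acta Math. 211 (2013) §5.
-/

noncomputable section

open Finset Real Matrix
open Literature.NumberTheory.Transcendental

namespace Summit.ABC.StewartYu

namespace G3Setup

variable {p : ℕ} [Fact p.Prime] (S : G3Setup p) (F : S.SatData) (P : PadicG3ParN S.n) (b : ℝ)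

/-! ### Nodes (transfer from the `Vb` schedule) -/

/-- k-step nodes: `NS lev (ν+1) ≤ 2^{lev+n}·9·HV` for `ν + 1 ≤ n`. [folklore] -/
theorem NS_N_le_HV {lev ν : ℕ} (hν : ν + 1 ≤ S.n) : (S.NS (P.schedN b) lev (ν + 1) : ℝ) ≤ 2 ^ (lev + S.n) * (9 * P.HV) := by
  rw [S.NS_N_eq_Vb P b]; exact S.NS_Vb_le_HV P.toPadicG3Par b hν

/-- START nodes: `NS 0 0 ≤ 2^{0+n}·9·HV`. [folklore] -/
theorem NS00_N_le_HV : (S.NS (P.schedN b) 0 0 : ℝ) ≤ 2 ^ (0 + S.n) * (9 * P.HV) := by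
  rw [S.NS_N_eq_Vb P b]; exact S.NS00_Vb_le_HV P.toPadicG3Par b

/-- half-step points: `2·NhS (lev+1) − 1 ≤ 2^{(lev+1)+n}·9·HV` (`n ≥ 1`). [folklore] -/
theorem halfNodes_N_le_HV (hn : 1 ≤ S.n) (lev : ℕ) :
    ((2 * (S.NhS (P.schedN b) (lev + 1) : ℤ) - 1 : ℤ) : ℝ) ≤ 2 ^ ((lev + 1) + S.n) * (9 * P.HV) :=
  S.halfNodes_Vb_le_HV P.toPadicG3Par b hn lev

/-- k-step nodes: `2·NS lev (ν+1)·(n LV/2^lev) ≤ 2·htsV ν`. [folklore] -/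
theorem nodes_height_N_le (lev ν : ℕ) : 2 * (S.NS (P.schedN b) lev (ν + 1) : ℝ) * (S.n * P.LV / 2 ^ lev) ≤ 2 * P.htsV ν := by
  rw [S.NS_N_eq_Vb P b]; exact S.nodes_height_Vb_le P.toPadicG3Par b lev ν

/-- START nodes: `2·NS 0 0·(n LV) ≤ htsV 0`. [folklore] -/
theorem start_height_N_le : 2 * (S.NS (P.schedN b) 0 0 : ℝ) * (S.n * P.LV) ≤ P.htsV 0 := by
  rw [S.NS_N_eq_Vb P b]; exact S.start_height_Vb_le P.toPadicG3Par b

/-- half-step points: `|s₁|·(n·LV/2^lev) ≤ (2gXV + 1)·(n·LV)` for `|s₁| ≤ 2·NhS (lev+1) − 1`. [folklore] -/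
theorem abs_half_mul_le (lev : ℕ) {s₁ : ℤ} (hs : |s₁| ≤ (2 * (S.NhS (P.schedN b) (lev + 1) : ℤ) - 1 : ℤ)) :
    |(s₁ : ℝ)| * (S.n * P.LV / 2 ^ lev) ≤ (2 * P.g * P.XV + 1) * (S.n * P.LV) := by
  rw [S.NhS_N P b] at hs
  have hs' : |(s₁ : ℝ)| ≤ 2 * (P.XsV (lev + 1) : ℝ) - 1 := by
    have : ((|s₁| : ℤ) : ℝ) ≤ ((2 * (P.XsV (lev + 1) : ℤ) - 1 : ℤ) : ℝ) := by exact_mod_cast hs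
    push_cast at this
    exact this
  have hX := P.XsV_le (lev + 1)
  have hg : 0 ≤ P.g := le_trans zero_le_one P.one_le_g
  have hXV : (0 : ℝ) ≤ P.XV := by positivity
  have hnL : (0 : ℝ) ≤ S.n * P.LV := by positivity
  have h2l : (0 : ℝ) < 2 ^ lev := by positivity
  have h1 : |(s₁ : ℝ)| ≤ 2 ^ lev * (2 * P.g * P.XV + 1) := by
    have h1' : (1 : ℝ) ≤ 2 ^ lev := one_le_pow₀ (by norm_num)
    rw [pow_succ] at hX
    nlinarith
  calc |(s₁ : ℝ)| * (S.n * P.LV / 2 ^ lev) = |(s₁ : ℝ)| / 2 ^ lev * (S.n * P.LV) := by field_simp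
    _ ≤ (2 * P.g * P.XV + 1) * (S.n * P.LV) := by
        refine mul_le_mul_of_nonneg_right ?_ hnL
        rw [div_le_iff₀ h2l]; linarith

/-! ### The virtual box `svS = N·side` -/

/-- `svS F (schedN b) j = N · sideS₂ (schedVb b) j`. [folklore] -/
theorem svS_N_eq (j : Fin S.n) : S.svS F (P.schedN b) j = F.N * S.sideS₂ (P.toPadicG3Par.schedVb b) j := rfl

/-- `Lb (svS) lev j / N ≤ LV/(2^lev·Aⱼ)` for `b ≥ 1`. [folklore] -/
theorem Lb_svS_div_le (hb : 1 ≤ b) (lev : ℕ) (j : Fin S.n) :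
    (S.Lb (S.svS F (P.schedN b)) lev j : ℝ) / F.N ≤ P.LV / (2 ^ lev * P.A j) := by
  have hN : (0 : ℝ) < F.N := by exact_mod_cast F.hN
  have h1 := S.Lb_le_real (S.svS F (P.schedN b)) lev j
  have h2 := S.sideS₂_N_le P b hb j
  have hA := P.A_pos j
  rw [div_le_iff₀ hN]
  refine h1.trans ?_
  rw [S.svS_N_eq F P b, ← S.sideS₂_N_eq P b]
  push_cast
  have h2l : (0 : ℝ) < 2 ^ lev := by positivity
  calc 2 * ((F.N : ℝ) * (S.sideS₂ (P.schedN b) j : ℝ)) / 2 ^ lev ≤ 2 * ((F.N : ℝ) * (P.LV / (2 * P.A j))) / 2 ^ lev := by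
        gcongr
    _ = P.LV / (2 ^ lev * P.A j) * F.N := by field_simp

/-- `Σⱼ (Lb (svS) lev j / N)·Aⱼ ≤ n·LV/2^lev`. [folklore] -/
theorem sum_Lb_svS_div_mul_A_le (hb : 1 ≤ b) (lev : ℕ) :
    ∑ j, (S.Lb (S.svS F (P.schedN b)) lev j : ℝ) / F.N * P.A j ≤ S.n * P.LV / 2 ^ lev := by
  have h : ∀ j ∈ (Finset.univ : Finset (Fin S.n)), (S.Lb (S.svS F (P.schedN b)) lev j : ℝ) / F.N * P.A j ≤ P.LV / 2 ^ lev := by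
    intro j _
    have h1 := S.Lb_svS_div_le F P b hb lev j
    have hA := P.A_pos j
    calc (S.Lb (S.svS F (P.schedN b)) lev j : ℝ) / F.N * P.A j ≤ P.LV / (2 ^ lev * P.A j) * P.A j :=
          mul_le_mul_of_nonneg_right h1 hA.le
      _ = P.LV / 2 ^ lev := by field_simp
  calc ∑ j, (S.Lb (S.svS F (P.schedN b)) lev j : ℝ) / F.N * P.A j ≤ ∑ _j : Fin S.n, (P.LV : ℝ) / 2 ^ lev := Finset.sum_le_sum h
    _ = S.n * P.LV / 2 ^ lev := by rw [Finset.sum_const, Finset.card_univ, Fintype.card_fin, nsmul_eq_mul]; ring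

/-- `2·Lb (svS) Ŝ j ≤ D j` whenever `K·N·LV/(2^Ŝ·Aⱼ)·… ` — the END box comparison in the form the record states it:
`2·Lb(svS) lev j ≤ 4·N·side j/2^lev + 2 ≤ …` is NOT needed here; we only record the real bound `2·Lb lev j ≤ 4 N·LV/(2^lev·2Aⱼ)`. [folklore] -/
theorem two_Lb_svS_le (hb : 1 ≤ b) (lev : ℕ) (j : Fin S.n) :
    (2 * S.Lb (S.svS F (P.schedN b)) lev j : ℝ) ≤ 2 * (F.N * (P.LV / (2 ^ lev * P.A j))) := by
  have hN : (0 : ℝ) < F.N := by exact_mod_cast F.hN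
  have h := S.Lb_svS_div_le F P b hb lev j
  rw [div_le_iff₀ hN] at h
  linarith

/-! ### The virtual denominators `Dm`, `Dh` -/

/-- **`log Dm(Lb svS lev, x) ≤ 2|x|·(n·LV/2^lev) + 2·ΣAⱼ`** (`h(αoⱼ) ≤ Aⱼ`). [cite: Nesterenko2003, §3.2; shape only] -/
theorem log_Dm_N_le (hb : 1 ≤ b) (hαA : ∀ j, Height.logHeight₁ (F.αo j) ≤ P.A j) (lev : ℕ) (x : ℤ) :
    Real.log (F.Dm (S.Lb (S.svS F (P.schedN b)) lev) x : ℝ) ≤ 2 * |(x : ℝ)| * (S.n * P.LV / 2 ^ lev) + 2 * ∑ j, P.A j := by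
  have h1 := F.log_Dm_le_of_weights (S.Lb (S.svS F (P.schedN b)) lev) x P.A hαA
  have h2 := S.sum_Lb_svS_div_mul_A_le F P b hb lev
  have h0 : (0 : ℝ) ≤ 2 * |(x : ℝ)| := by positivity
  nlinarith [mul_le_mul_of_nonneg_left h2 h0]

/-- **`log Dh(Lb svS lev, s) ≤ |s|·(n·LV/2^lev) + (n+2)·ΣAⱼ`** (`h(αoⱼ) ≤ Aⱼ`, `Σᵢ|Uᵢⱼ| ≤ n·N`). [cite: Nesterenko2003, §3.2; shape only] -/
theorem log_Dh_N_le (hb : 1 ≤ b) (hαA : ∀ j, Height.logHeight₁ (F.αo j) ≤ P.A j) (hUcol : ∀ j, (F.Ucol j : ℤ) ≤ S.n * F.N)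
    (lev : ℕ) (s : ℤ) :
    Real.log (F.Dh (S.Lb (S.svS F (P.schedN b)) lev) s : ℝ) ≤ |(s : ℝ)| * (S.n * P.LV / 2 ^ lev) + (S.n + 2) * ∑ j, P.A j := by
  have hN : (0 : ℝ) < F.N := by exact_mod_cast F.hN
  have h1 := F.log_Dh_le_of_weights (S.Lb (S.svS F (P.schedN b)) lev) s P.A hαA
  have h2 := S.sum_Lb_svS_div_mul_A_le F P b hb lev
  have h3 : ∑ j, (F.Ucol j : ℝ) / F.N * P.A j ≤ S.n * ∑ j, P.A j := by
    rw [Finset.mul_sum]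
    refine Finset.sum_le_sum fun j _ => mul_le_mul_of_nonneg_right ?_ (P.A_pos j).le
    rw [div_le_iff₀ hN]
    have := hUcol j
    exact_mod_cast this
  have h0 : (0 : ℝ) ≤ |(s : ℝ)| := abs_nonneg _
  nlinarith [mul_le_mul_of_nonneg_left h2 h0]

/-! ### The θ-box `LcS` -/

/-- `(LcS k : ℤ) = Σⱼ sideⱼ·|C_jk|`. [folklore] -/
theorem cast_LcS (Sc : G3Sched S.n) (k : Fin S.n) : (S.LcS F Sc k : ℤ) = ∑ j, (S.sideS₂ Sc j : ℤ) * |F.C j k| := by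
  unfold LcS
  exact Int.toNat_of_nonneg (Finset.sum_nonneg fun j _ => mul_nonneg (by positivity) (abs_nonneg _))

/-- **`LcS k ≤ n!·N·(n·LV/2)`** for `b ≥ 1`, `Aⱼ ≥ 1`, `|C_jk| ≤ n!·N`. [folklore] -/
theorem LcS_N_le (hb : 1 ≤ b) (hA1 : ∀ j, 1 ≤ P.A j) (hC : ∀ j k, |F.C j k| ≤ ((S.n.factorial * F.N : ℕ) : ℤ)) (k : Fin S.n) :
    (S.LcS F (P.schedN b) k : ℝ) ≤ (S.n.factorial : ℝ) * F.N * (S.n * P.LV / 2) := by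
  have hcast : (S.LcS F (P.schedN b) k : ℝ) = ∑ j, (S.sideS₂ (P.schedN b) j : ℝ) * (|F.C j k| : ℤ) := by
    have h := S.cast_LcS F (P.schedN b) k
    have : ((S.LcS F (P.schedN b) k : ℤ) : ℝ) = ((∑ j, (S.sideS₂ (P.schedN b) j : ℤ) * |F.C j k| : ℤ) : ℝ) := by rw [h]
    push_cast at this ⊢
    exact this
  rw [hcast]
  have hside : ∀ j, (S.sideS₂ (P.schedN b) j : ℝ) ≤ P.LV / 2 := by
    intro j
    have h := S.sideS₂_N_le P b hb j
    have hA := hA1 j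
    have hL : (0 : ℝ) ≤ P.LV := by positivity
    refine h.trans ?_
    rw [div_le_div_iff₀ (by linarith) (by norm_num)]
    nlinarith
  have hCr : ∀ j, ((|F.C j k| : ℤ) : ℝ) ≤ (S.n.factorial : ℝ) * F.N := by
    intro j; have := hC j k; exact_mod_cast this
  calc ∑ j, (S.sideS₂ (P.schedN b) j : ℝ) * ((|F.C j k| : ℤ) : ℝ) ≤ ∑ _j : Fin S.n, P.LV / 2 * ((S.n.factorial : ℝ) * F.N) :=
        Finset.sum_le_sum fun j _ => mul_le_mul (hside j) (hCr j) (by positivity) (by positivity)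
    _ = (S.n.factorial : ℝ) * F.N * (S.n * P.LV / 2) := by
        rw [Finset.sum_const, Finset.card_univ, Fintype.card_fin, nsmul_eq_mul]; ring

/-- **`Σₖ Lb (LcS) lev k ≤ n²·n!·N·LV/2^lev`**. [folklore] -/
theorem sum_Lb_LcS_N_le (hb : 1 ≤ b) (hA1 : ∀ j, 1 ≤ P.A j) (hC : ∀ j k, |F.C j k| ≤ ((S.n.factorial * F.N : ℕ) : ℤ)) (lev : ℕ) :
    ∑ k, (S.Lb (S.LcS F (P.schedN b)) lev k : ℝ) ≤ S.n ^ 2 * S.n.factorial * F.N * P.LV / 2 ^ lev := by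
  have h2l : (0 : ℝ) < 2 ^ lev := by positivity
  have h : ∀ k ∈ (Finset.univ : Finset (Fin S.n)), (S.Lb (S.LcS F (P.schedN b)) lev k : ℝ) ≤ S.n * S.n.factorial * F.N * P.LV / 2 ^ lev := by
    intro k _
    have h1 := S.Lb_le_real (S.LcS F (P.schedN b)) lev k
    have h2 := S.LcS_N_le F P b hb hA1 hC k
    refine h1.trans ?_
    rw [div_le_div_iff₀ h2l h2l]
    have : (0 : ℝ) ≤ 2 ^ lev := h2l.le
    nlinarith
  calc ∑ k, (S.Lb (S.LcS F (P.schedN b)) lev k : ℝ) ≤ ∑ _k : Fin S.n, (S.n : ℝ) * S.n.factorial * F.N * P.LV / 2 ^ lev := Finset.sum_le_sum h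
    _ = S.n ^ 2 * S.n.factorial * F.N * P.LV / 2 ^ lev := by
        rw [Finset.sum_const, Finset.card_univ, Fintype.card_fin, nsmul_eq_mul]; ring

/-- **The directional bound on the θ-box**: `XbC (Lb LcS lev) ≤ exp(log 2 + 3 log n + log n! + log N + W + log LV)` (`n ≥ 1`).
[folklore] -/
theorem XbC_LcS_N_le_exp (hb : 1 ≤ b) (hn : 1 ≤ S.n) (hA1 : ∀ j, 1 ≤ P.A j) (hbW : ∀ j, Real.log (max 3 (|S.b j| : ℝ)) ≤ P.W)
    (hC : ∀ j k, |F.C j k| ≤ ((S.n.factorial * F.N : ℕ) : ℤ)) (lev : ℕ) :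
    (S.XbC (S.Lb (S.LcS F (P.schedN b)) lev) : ℝ) ≤
      Real.exp (Real.log 2 + 3 * Real.log S.n + Real.log S.n.factorial + Real.log F.N + P.W + Real.log P.LV) := by
  have h1 := S.XbC_le hbW (S.Lb (S.LcS F (P.schedN b)) lev)
  have h2 := S.sum_Lb_LcS_N_le F P b hb hA1 hC lev
  have hn' : (0 : ℝ) < S.n := by exact_mod_cast hn
  have hN : (0 : ℝ) < F.N := by exact_mod_cast F.hN
  have hfa : (0 : ℝ) < S.n.factorial := by exact_mod_cast S.n.factorial_pos
  have hL : (0 : ℝ) < P.LV := by linarith [P.one_le_LV]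
  have hexp : Real.exp (Real.log 2 + 3 * Real.log S.n + Real.log S.n.factorial + Real.log F.N + P.W + Real.log P.LV) =
      2 * S.n ^ 3 * S.n.factorial * F.N * Real.exp P.W * P.LV := by
    rw [Real.exp_add, Real.exp_add, Real.exp_add, Real.exp_add, Real.exp_add, Real.exp_log (by norm_num), Real.exp_log hL,
      Real.exp_log hN, Real.exp_log hfa, show (3 : ℝ) * Real.log S.n = Real.log (S.n ^ 3) by rw [Real.log_pow]; norm_num,
      Real.exp_log (by positivity)]
  rw [hexp]
  have h0 : (0 : ℝ) ≤ 2 * S.n * Real.exp P.W := by positivity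
  calc (S.XbC (S.Lb (S.LcS F (P.schedN b)) lev) : ℝ) ≤ 2 * S.n * Real.exp P.W * ∑ k, (S.Lb (S.LcS F (P.schedN b)) lev k : ℝ) := h1
    _ ≤ 2 * S.n * Real.exp P.W * (S.n ^ 2 * S.n.factorial * F.N * P.LV / 2 ^ lev) := mul_le_mul_of_nonneg_left h2 h0
    _ ≤ 2 * S.n * Real.exp P.W * (S.n ^ 2 * S.n.factorial * F.N * P.LV) := by
        refine mul_le_mul_of_nonneg_left (div_le_self (by positivity) (one_le_pow₀ (by norm_num))) h0
    _ = 2 * S.n ^ 3 * S.n.factorial * F.N * Real.exp P.W * P.LV := by ring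

/-- powers: `XbC (Lb LcS lev)^t ≤ exp(t·(log 2 + 3 log n + log n! + log N + W + log LV))`. [folklore] -/
theorem XbC_LcS_pow_N_le (hb : 1 ≤ b) (hn : 1 ≤ S.n) (hA1 : ∀ j, 1 ≤ P.A j) (hbW : ∀ j, Real.log (max 3 (|S.b j| : ℝ)) ≤ P.W)
    (hC : ∀ j k, |F.C j k| ≤ ((S.n.factorial * F.N : ℕ) : ℤ)) (lev t : ℕ) :
    (S.XbC (S.Lb (S.LcS F (P.schedN b)) lev) : ℝ) ^ t ≤
      Real.exp (t * (Real.log 2 + 3 * Real.log S.n + Real.log S.n.factorial + Real.log F.N + P.W + Real.log P.LV)) := by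
  rw [Real.exp_nat_mul]
  exact pow_le_pow_left₀ (S.XbC_nonneg _) (S.XbC_LcS_N_le_exp F P b hb hn hA1 hbW hC lev) t

/-- the START's `XbSSat = max 1 (XbC (Lb LcS 0)) ≤ exp(log 2 + 3 log n + log n! + log N + W + log LV)`. [folklore] -/
theorem XbSSat_N_le (hb : 1 ≤ b) (hn : 1 ≤ S.n) (hA1 : ∀ j, 1 ≤ P.A j) (hbW : ∀ j, Real.log (max 3 (|S.b j| : ℝ)) ≤ P.W)
    (hC : ∀ j k, |F.C j k| ≤ ((S.n.factorial * F.N : ℕ) : ℤ)) :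
    (S.XbSSat F (P.schedN b) : ℝ) ≤
      Real.exp (Real.log 2 + 3 * Real.log S.n + Real.log S.n.factorial + Real.log F.N + P.W + Real.log P.LV) := by
  rw [S.XbSSat_cast F (P.schedN b)]
  refine max_le ?_ (S.XbC_LcS_N_le_exp F P b hb hn hA1 hbW hC 0)
  refine Real.one_le_exp ?_
  have h1 : 0 ≤ Real.log 2 := Real.log_nonneg (by norm_num)
  have h2 : 0 ≤ Real.log (S.n : ℝ) := Real.log_nonneg (by exact_mod_cast hn)
  have h3 : 0 ≤ Real.log (P.LV : ℝ) := Real.log_nonneg P.one_le_LV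
  have h4 : 0 ≤ Real.log (S.n.factorial : ℝ) := Real.log_nonneg (by exact_mod_cast S.n.factorial_pos)
  have h5 : 0 ≤ Real.log (F.N : ℝ) := Real.log_nonneg (by exact_mod_cast F.hN)
  linarith [P.hW]

/-- **`log UcardSat ≤ log(L0N + 1) + n·log(n²·n!·N·LV + 1)`** (`2·LcS k + 1 ≤ n·n!·N·LV + 1`). [folklore] -/
theorem log_UcardSat_N_le (hb : 1 ≤ b) (hA1 : ∀ j, 1 ≤ P.A j) (hC : ∀ j k, |F.C j k| ≤ ((S.n.factorial * F.N : ℕ) : ℤ)) :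
    Real.log (S.UcardSat F (P.schedN b) : ℝ) ≤ Real.log ((P.L0N : ℝ) + 1) + S.n * Real.log (S.n * S.n.factorial * F.N * P.LV + 1) := by
  have h := S.log_UcardSat_le F (P.schedN b)
  rw [P.schedN_L₀] at h
  refine h.trans ?_
  gcongr log ((P.L0N : ℝ) + 1) + ?_
  have hk : ∀ k ∈ (Finset.univ : Finset (Fin S.n)), Real.log (2 * (S.LcS F (P.schedN b) k : ℝ) + 1) ≤
      Real.log (S.n * S.n.factorial * F.N * P.LV + 1) := by
    intro k _
    have h1 := S.LcS_N_le F P b hb hA1 hC k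
    refine Real.log_le_log (by positivity) ?_
    nlinarith
  calc ∑ k, Real.log (2 * (S.LcS F (P.schedN b) k : ℝ) + 1) ≤ ∑ _k : Fin S.n, Real.log (S.n * S.n.factorial * F.N * P.LV + 1) :=
        Finset.sum_le_sum hk
    _ = S.n * Real.log (S.n * S.n.factorial * F.N * P.LV + 1) := by
        rw [Finset.sum_const, Finset.card_univ, Fintype.card_fin, nsmul_eq_mul]

/-! ### The `L₀`-factor of `M0C` with `L0N`, `ŜN` -/

/-- `L0N·(1 + log(1 + 2^{ŜN−lev}|x|/HV)) ≤ L0N·(ŜN + n + 6)·log 2` for `|x| ≤ 2^{lev+n}·9·HV`, `lev ≤ ŜN`. [folklore] -/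
theorem L0_factor_N_le {lev : ℕ} (hlev : lev ≤ P.SdN) {x : ℤ} (hx : (|x| : ℝ) ≤ 2 ^ (lev + S.n) * (9 * P.HV)) :
    (P.L0N : ℝ) * (1 + Real.log (1 + |((2 ^ (P.SdN - lev) * x : ℤ) : ℝ)| / P.HV)) ≤ P.L0N * ((P.SdN + S.n + 6) * Real.log 2) := by
  have hH : (1 : ℝ) ≤ P.HV := by exact_mod_cast P.one_le_HV
  have hcast : |((2 ^ (P.SdN - lev) * x : ℤ) : ℝ)| = 2 ^ (P.SdN - lev) * |(x : ℝ)| := by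
    push_cast; rw [abs_mul, abs_of_nonneg (by positivity : (0 : ℝ) ≤ 2 ^ (P.SdN - lev))]
  rw [hcast]
  have hratio : 2 ^ (P.SdN - lev) * |(x : ℝ)| / P.HV ≤ 9 * 2 ^ (P.SdN + S.n) := by
    rw [div_le_iff₀ (by linarith)]
    have e : (2 : ℝ) ^ (P.SdN - lev) * (2 ^ (lev + S.n) * (9 * P.HV)) = 9 * 2 ^ (P.SdN + S.n) * P.HV := by
      rw [show P.SdN + S.n = (P.SdN - lev) + (lev + S.n) by omega, pow_add]; ring
    calc (2 : ℝ) ^ (P.SdN - lev) * |(x : ℝ)| ≤ 2 ^ (P.SdN - lev) * (2 ^ (lev + S.n) * (9 * P.HV)) :=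
          mul_le_mul_of_nonneg_left hx (by positivity)
      _ = 9 * 2 ^ (P.SdN + S.n) * P.HV := e
  have h1 : 1 + 2 ^ (P.SdN - lev) * |(x : ℝ)| / P.HV ≤ 2 ^ (P.SdN + S.n + 4) := by
    have h16 : (1 : ℝ) ≤ 2 ^ (P.SdN + S.n) := one_le_pow₀ (by norm_num)
    have e4 : (2 : ℝ) ^ (P.SdN + S.n + 4) = 2 ^ (P.SdN + S.n) * 16 := by rw [pow_add]; norm_num
    rw [e4]
    linarith
  have hpos : 0 < 1 + 2 ^ (P.SdN - lev) * |(x : ℝ)| / P.HV := by positivity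
  have hlog : Real.log (1 + 2 ^ (P.SdN - lev) * |(x : ℝ)| / P.HV) ≤ (P.SdN + S.n + 4) * Real.log 2 := by
    calc Real.log (1 + 2 ^ (P.SdN - lev) * |(x : ℝ)| / P.HV) ≤ Real.log (2 ^ (P.SdN + S.n + 4)) := Real.log_le_log hpos h1
      _ = (P.SdN + S.n + 4) * Real.log 2 := by rw [Real.log_pow]; push_cast; ring
  have hl2 : (1 : ℝ) ≤ 2 * Real.log 2 := by have := Real.log_two_gt_d9; linarith
  have hL0 : (0 : ℝ) ≤ P.L0N := by positivity
  refine mul_le_mul_of_nonneg_left ?_ hL0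
  linarith

/-- **`M0C L0N HV ŜN lev x t₀ ≤ exp(log 2 + t₀·(ŜN·log 2 + (23/20)HV) + HV/e + L0N(ŜN+n+6) log 2)`** at admissible nodes.
[cite: Nesterenko2003, (3.8); shape only] -/
theorem M0C_N_le_exp {lev : ℕ} (hlev : lev ≤ P.SdN) {x : ℤ} (hx : (|x| : ℝ) ≤ 2 ^ (lev + S.n) * (9 * P.HV)) (t₀ : ℕ) :
    (M0C P.L0N P.HV P.SdN lev x t₀ : ℝ) ≤ Real.exp (Real.log 2 + t₀ * (P.SdN * Real.log 2 + 23 / 20 * P.HV) + P.HV / Real.exp 1 +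
      P.L0N * ((P.SdN + S.n + 6) * Real.log 2)) := by
  have h := log_M0C_le_sharp P.L0N P.HV P.SdN lev x t₀
  have hL := S.L0_factor_N_le P hlev hx
  have hS : ((P.SdN - lev : ℕ) : ℝ) ≤ P.SdN := by exact_mod_cast Nat.sub_le _ _
  have ht0 : (0 : ℝ) ≤ t₀ := by positivity
  have hl2 : 0 ≤ Real.log 2 := Real.log_nonneg (by norm_num)
  have hMpos := M0C_pos P.L0N P.HV P.SdN lev x t₀
  rw [← Real.exp_log hMpos]
  refine Real.exp_le_exp.mpr (h.trans ?_)
  nlinarith [mul_le_mul_of_nonneg_right hS (mul_nonneg ht0 hl2)]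

end G3Setup

end Summit.ABC.StewartYu

end
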